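import Summits.BirchSwinnertonDyer.BirchSwinnertonDyer.Theorems.CMKolyvaginAtInertTwoHabitatPerCellInputsAtTwo
import HarnessLib

/-!
# Route `CMKolyvaginAtInertTwo` — THE LEAF `WAllCornerFTwo` FROM THE CELL ITEMS (a per-cell deciding theorem, kernel-certified by name)

Seat `bsd-line-cmk2-p1` g24 (cell `bsd-print-cf2`), `--supports stmt-BirchSwinnertonDyer-28176` (helper; closes nothing by name).
THEOREMS ONLY (no definition, no named fact, no `sorry`).  BSD is NOT proved by this; `WAllCornerFTwo` is NOT proved by this (CONDITIONAL).

`wAllCornerFTwo_of_cellItems_of_printedInputs`: the registered leaf `Summit.BirchSwinnertonDyer.WAllCornerFTwo` (rung W-ALL/12.K12-2) follows from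
— prints: Gross–Zagier all levels (24148), GZK (19921), `exists_isNewformOf` (19382), Milne any-model (24149), Burungale–Flach (19423),
  Burungale–Tian 2026 (the pen's `BurungaleTianRankZeroConverse`), Gross 3.7 (2) for all frames (28665);
— «R0ᴹᴿ» (R0 at the Mazur–Rubin primes, on `#Sel₂(E) = 2`; text = binder `hR0MR`; candidate item, weaker than 28176);
— 28177 `CMKolyvaginDescentOfNontrivialShaTwo` (by name);
— «HL′₁ᶜ» (the one-bit-field Selmer residual of 28663 off `#Sel₂(E) = 2`; text = binder `hHL₁`; candidate item);
— 22838 `OffHabitatCMResidualAtTwo` (by name).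
This is the shape of a per-cell `closes` (the pen's call; no window asked): compared with rev 22, the binders 24648, 28176, 28663, 28664,
28666/28667, 24154, 19273 are replaced by R0ᴹᴿ, HL′₁ᶜ and the Burungale–Tian print.  `wAllCornerFTwo_of_cellItems_of_isogenyResidual` is the
variant with the residual shrunk by the isogeny classes of the habitat (Cassels' `bsdRHS_eq_of_isIsogenous` as one more print binder).

References: [MazurRubin2010] Cor. 3.4 (i); [BurungaleTian2026] Thm. 1.1; [BurungaleFlach2024] Thm. 1.1, Cor. 2; [GrossLMS1991] Prop. 3.7 (2), §11;
[McCallumLMS1991] §5; [Cassels1965ArithmeticVIII]; [MilneADT2006] Thm. I.7.3.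
-/

set_option autoImplicit false
-- the Theorems namespace of this sub repeats the summit name by design (D-0017 nested layout)
set_option linter.dupNamespace false

noncomputable section

open scoped Classical

open WeierstrassCurve NumberField Literature.NumberTheory.EllipticCurves
  Literature.NumberTheory.EllipticCurves.ModularForms
  Literature.NumberTheory.EllipticCurves.Rank1Residual
open Summit.BirchSwinnertonDyer.BirchSwinnertonDyer.Theses.CMKolyvaginAtInertTwo
  (CMKolyvaginDescentOfNontrivialShaTwo Prop37ReductionCongruenceInertAll OffHabitatCMResidualAtTwo GrossZagierAllLevels
    MultPublishedInputsAtTwo ModularityExistsNewform MilneAnyModel CMRankZeroBSDTriple)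

namespace Summit.BirchSwinnertonDyer.BirchSwinnertonDyer.Theorems.KolyvaginLowerTwo

/-- **THE LEAF FROM THE CELL ITEMS** (per-cell deciding-theorem shape): prints (by the route's support items) ∧ Burungale–Tian ∧ 28665 ∧ «R0ᴹᴿ» ∧
28177 ∧ «HL′₁ᶜ» ∧ 22838 ⟹ `Summit.BirchSwinnertonDyer.WAllCornerFTwo`.  Habitat branch = `bsdp_two_onHabitat_of_cellItems_of_printedInputs`
(p769589); off the habitat = 22838 verbatim.  CONDITIONAL; nothing is closed by this; BSD is NOT proved.
[cite: MazurRubin2010, Cor. 3.4 (i)] [cite: BurungaleTian2026, Thm. 1.1] [cite: BurungaleFlach2024, Cor. 2] [cite: GrossLMS1991, Prop. 3.7 (2)] -/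
theorem wAllCornerFTwo_of_cellItems_of_printedInputs (hGZ : GrossZagierAllLevels) (hGZK : MultPublishedInputsAtTwo) (hnf : ModularityExistsNewform)
    (hMi : MilneAnyModel) (hBF : CMRankZeroBSDTriple) (hBT : burungaleTian_analyticRank_eq_zero_of_selmerCorank_eq_zero_of_hasCM)
    (h37 : Prop37ReductionCongruenceInertAll)
    (hR0MR : ∀ (W : WeierstrassCurve ℚ) [W.IsElliptic] [W.IsGloballyMinimal] [NeZero (W.conductorNorm ℤ)], W.HasCM →
      Rank1Residual.CMInert W 2 → W.HasSurjectiveModNGaloisRep (2 : ℤ) → W.analyticRank = 1 → Odd W.tamagawaProduct →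
      Nat.card (W.selmerGroup 2) = 2 → ∀ (ℓ : ℕ) [Fact ℓ.Prime], ℓ % 8 = 7 → (4 * W.conductorNorm ℤ : ℕ) ∣ ℓ + 1 →
      ¬ W.selmerGroup 2 ≤ MazurRubin2010.strictLocalKer W ℚ_[ℓ] 2 →
      ∀ (K : Type) [Field K] [NumberField K], IsImaginaryQuadratic K → NumberField.discr K = -(ℓ : ℤ) →
      SatisfiesHeegnerHypothesis (W.conductorNorm ℤ) K → ((Ideal.span {(2 : ℤ)}).primesOver (𝓞 K)).ncard = 2 →
      ∀ (Dt : ModularParametrizationData W (W.conductorNorm ℤ)),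
      (∀ z ∈ Dt.L.lattice, ∃ w ∈ periodLattice Dt.f, z = (Dt.c : ℂ) * w) → Odd Dt.c →
      ∀ (β : ℤ) (ι : K →+* ℂ) (d₁ : KolyvaginHeegnerData Dt β ι 1), ¬ IsOfFinAddOrder d₁.derivedPoint →
      ¬ ∃ Q : (W.baseChange (ringClassField K ι 1)).toAffine.Point, (2 : ℤ) • Q = d₁.derivedPoint)
    (hR1 : CMKolyvaginDescentOfNontrivialShaTwo)
    (hHL₁ : ∀ (W : WeierstrassCurve ℚ) [W.IsElliptic] [W.IsGloballyMinimal] [NeZero (W.conductorNorm ℤ)],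
      W.HasCM → Rank1Residual.CMInert W 2 → W.HasSurjectiveModNGaloisRep (2 : ℤ) → W.analyticRank = 1 →
      Nat.card (W.selmerGroup 2) ≠ 2 →
      ∃ (K : Type) (_ : Field K) (_ : NumberField K), IsImaginaryQuadratic K ∧ Odd (NumberField.discr K) ∧
        NumberField.discr K ≠ -3 ∧ SatisfiesHeegnerHypothesis (W.conductorNorm ℤ) K ∧
        (∑ q ∈ (NumberField.discr K).natAbs.primeFactors,
          ((if jacobiSym W.Δ.num q = -1 then 1 else 0) + (if jacobiSym W.Δ.num q = 1 ∧ Even (W.frobeniusTrace q) then 2 else 0)) ≤ 1) ∧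
        ∃ ℓ : ℕ, ℓ.Prime ∧ (W.quadraticTwist (NumberField.discr K : ℚ)).selmerCorank ℓ = 0)
    (hR : OffHabitatCMResidualAtTwo) :
    Summit.BirchSwinnertonDyer.WAllCornerFTwo := by
  intro W _ _ hcm hr
  haveI : NeZero (W.conductorNorm ℤ) := ⟨(W.conductorNorm_pos_holds).ne'⟩
  by_cases hH : (Rank1Residual.CMInert W 2 ∧ W.HasSurjectiveModNGaloisRep (2 : ℤ) ∧ Odd W.tamagawaProduct ∧
        ∃ Dt : ModularParametrizationData W (W.conductorNorm ℤ),
          (∀ z ∈ Dt.L.lattice, ∃ w ∈ periodLattice Dt.f, z = (Dt.c : ℂ) * w) ∧ Odd Dt.c)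
  · obtain ⟨hin, hρ, hT, hopt⟩ := hH
    exact bsdp_two_onHabitat_of_cellItems_of_printedInputs hGZ hGZK hnf hMi hBF hBT h37 hR0MR hR1 hHL₁ W hcm hin hρ hr hT hopt
  · exact hR W hcm hr hH

/-- **THE LEAF FROM THE CELL ITEMS WITH THE ISOGENY-SHRUNK RESIDUAL**: as above, with 22838 replaced by its restriction to the CM curves of analytic
rank `1` off H₂ that are NOT ℚ-isogenous to a framed H₂ member, at the price of Cassels' isogeny invariance (print).  CONDITIONAL; BSD is NOT proved.
[cite: Cassels1965ArithmeticVIII] [cite: MilneADT2006, Thm. I.7.3 and Remark I.7.4] [cite: MazurRubin2010, Cor. 3.4 (i)] -/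
theorem wAllCornerFTwo_of_cellItems_of_isogenyResidual (hGZ : GrossZagierAllLevels) (hGZK : MultPublishedInputsAtTwo)
    (hnf : ModularityExistsNewform) (hMi : MilneAnyModel) (hBF : CMRankZeroBSDTriple)
    (hBT : burungaleTian_analyticRank_eq_zero_of_selmerCorank_eq_zero_of_hasCM) (hCas : bsdRHS_eq_of_isIsogenous)
    (h37 : Prop37ReductionCongruenceInertAll)
    (hR0MR : ∀ (W : WeierstrassCurve ℚ) [W.IsElliptic] [W.IsGloballyMinimal] [NeZero (W.conductorNorm ℤ)], W.HasCM →
      Rank1Residual.CMInert W 2 → W.HasSurjectiveModNGaloisRep (2 : ℤ) → W.analyticRank = 1 → Odd W.tamagawaProduct →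
      Nat.card (W.selmerGroup 2) = 2 → ∀ (ℓ : ℕ) [Fact ℓ.Prime], ℓ % 8 = 7 → (4 * W.conductorNorm ℤ : ℕ) ∣ ℓ + 1 →
      ¬ W.selmerGroup 2 ≤ MazurRubin2010.strictLocalKer W ℚ_[ℓ] 2 →
      ∀ (K : Type) [Field K] [NumberField K], IsImaginaryQuadratic K → NumberField.discr K = -(ℓ : ℤ) →
      SatisfiesHeegnerHypothesis (W.conductorNorm ℤ) K → ((Ideal.span {(2 : ℤ)}).primesOver (𝓞 K)).ncard = 2 →
      ∀ (Dt : ModularParametrizationData W (W.conductorNorm ℤ)),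
      (∀ z ∈ Dt.L.lattice, ∃ w ∈ periodLattice Dt.f, z = (Dt.c : ℂ) * w) → Odd Dt.c →
      ∀ (β : ℤ) (ι : K →+* ℂ) (d₁ : KolyvaginHeegnerData Dt β ι 1), ¬ IsOfFinAddOrder d₁.derivedPoint →
      ¬ ∃ Q : (W.baseChange (ringClassField K ι 1)).toAffine.Point, (2 : ℤ) • Q = d₁.derivedPoint)
    (hR1 : CMKolyvaginDescentOfNontrivialShaTwo)
    (hHL₁ : ∀ (W : WeierstrassCurve ℚ) [W.IsElliptic] [W.IsGloballyMinimal] [NeZero (W.conductorNorm ℤ)],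
      W.HasCM → Rank1Residual.CMInert W 2 → W.HasSurjectiveModNGaloisRep (2 : ℤ) → W.analyticRank = 1 →
      Nat.card (W.selmerGroup 2) ≠ 2 →
      ∃ (K : Type) (_ : Field K) (_ : NumberField K), IsImaginaryQuadratic K ∧ Odd (NumberField.discr K) ∧
        NumberField.discr K ≠ -3 ∧ SatisfiesHeegnerHypothesis (W.conductorNorm ℤ) K ∧
        (∑ q ∈ (NumberField.discr K).natAbs.primeFactors,
          ((if jacobiSym W.Δ.num q = -1 then 1 else 0) + (if jacobiSym W.Δ.num q = 1 ∧ Even (W.frobeniusTrace q) then 2 else 0)) ≤ 1) ∧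
        ∃ ℓ : ℕ, ℓ.Prime ∧ (W.quadraticTwist (NumberField.discr K : ℚ)).selmerCorank ℓ = 0)
    (hR' : ∀ (W : WeierstrassCurve ℚ) [W.IsElliptic] [W.IsGloballyMinimal] [NeZero (W.conductorNorm ℤ)], W.HasCM → W.analyticRank = 1 →
      ¬ (Rank1Residual.CMInert W 2 ∧ W.HasSurjectiveModNGaloisRep (2 : ℤ) ∧ Odd W.tamagawaProduct ∧
        ∃ Dt : ModularParametrizationData W (W.conductorNorm ℤ), (∀ z ∈ Dt.L.lattice, ∃ w ∈ periodLattice Dt.f, z = (Dt.c : ℂ) * w) ∧ Odd Dt.c) →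
      (¬ ∃ (W₀ : WeierstrassCurve ℚ) (_ : W₀.IsElliptic) (_ : W₀.IsGloballyMinimal) (_ : NeZero (W₀.conductorNorm ℤ)),
        IsIsogenous W W₀ ∧ W₀.HasCM ∧ Rank1Residual.CMInert W₀ 2 ∧ W₀.HasSurjectiveModNGaloisRep (2 : ℤ) ∧ Odd W₀.tamagawaProduct ∧
        ∃ Dt : ModularParametrizationData W₀ (W₀.conductorNorm ℤ), (∀ z ∈ Dt.L.lattice, ∃ w ∈ periodLattice Dt.f, z = (Dt.c : ℂ) * w) ∧ Odd Dt.c) →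
      BSDp W 2) :
    Summit.BirchSwinnertonDyer.WAllCornerFTwo := by
  have hHab := bsdp_two_onHabitat_of_cellItems_of_printedInputs hGZ hGZK hnf hMi hBF hBT h37 hR0MR hR1 hHL₁
  have hRes : OffHabitatCMResidualAtTwo :=
    offHabitatCMResidualAtTwo_of_habitat_of_isogenyResidual hGZK hnf hCas
      (fun W₀ _ _ _ hCM₀ hin₀ hρ₀ hr₀ hT₀ hfr₀ ↦ hHab W₀ hCM₀ hin₀ hρ₀ hr₀ hT₀ hfr₀) hR'
  intro W _ _ hcm hr
  haveI : NeZero (W.conductorNorm ℤ) := ⟨(W.conductorNorm_pos_holds).ne'⟩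
  by_cases hH : (Rank1Residual.CMInert W 2 ∧ W.HasSurjectiveModNGaloisRep (2 : ℤ) ∧ Odd W.tamagawaProduct ∧
        ∃ Dt : ModularParametrizationData W (W.conductorNorm ℤ),
          (∀ z ∈ Dt.L.lattice, ∃ w ∈ periodLattice Dt.f, z = (Dt.c : ℂ) * w) ∧ Odd Dt.c)
  · obtain ⟨hin, hρ, hT, hopt⟩ := hH
    exact hHab W hcm hin hρ hr hT hopt
  · exact hRes W hcm hr hH

end Summit.BirchSwinnertonDyer.BirchSwinnertonDyer.Theorems.KolyvaginLowerTwo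

end
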